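import Literature.Analysis.FluidPDE.NSEssEndpointReduced
import Literature.Analysis.FluidPDE.EssKatoL3LocalHolds
import HarnessLib

/-!
# ESS (1.14) and the endpoint criterion, reduced to ESS Theorem 1.4 alone

Analysis/FluidPDE proof file (theorems only: no definition, no named fact, no statement changed)
on the discharge path of the named facts
`Literature.Analysis.FluidPDE.ess_L5_integrability` (`NSLerayHopfProofs.lean`;
Escauriaza–Seregin–Šverák 2003, Thm. 1.3, conclusion (1.14): a Leray–Hopf weak solution of the
unforced Cauchy problem on `ℝ³ × [0, T)` lying in `L_{3,∞}(Q_T)` lies in `L₅(Q_T)`) and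
**ns.S08** `Literature.Analysis.FluidPDE.ess_endpoint` (`NSLerayHopf.lean`; ibid., Thm. 1.3 with
the uniqueness clause).

The accepted reductions `ess_L5_integrability_of_local_holder_of_kato` and
`ess_endpoint_of_local_holder_of_kato` (`NSEssEndpointReduced.lean`) prove both facts from two
named facts, following ESS 2003, §3 (proof of Thm. 1.3): the local theorem `ess_local_holder`
(ESS Thm. 1.4) and Kato's short-time `L³` theory `ess_kato_L3_local` (ESS Thm. 7.4 with
Remark 7.5) — the ε-regularity criterion (Lemma 2.2), the associated pressure ((3.2)–(3.4)), the
energy equality in `L⁴(Q_T)` and Ladyzhenskaya–Prodi–Serrin regularity (Thm. 1.2) being theorems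
of the tree. Kato's theory is now a theorem as well (`ess_kato_L3_local_holds`,
`EssKatoL3LocalHolds.lean`: Kato's mild solution is Leray–Hopf, continuous into `L³`, and in
`L⁵ ∩ L⁴(Q_T)`). This file plugs that discharge in:

* `ess_L5_integrability_of_local_holder : ess_local_holder → ess_L5_integrability`;
* `ess_endpoint_of_local_holder : ess_local_holder → ess_endpoint`.

Hence **the single open leaf under ESS (1.14) and under ns.S08 is ESS 2003, Thm. 1.4** (local
Hölder regularity of `L_{3,∞}` suitable pairs on the unit cylinder: blow-up around a putative
singular point, backward uniqueness for the heat operator in a half-space Thm. 5.1, unique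
continuation through spatial boundaries Thm. 4.1, the Carleman inequalities of §6); the kernel
certifies it (`#print axioms` of either theorem: `propext`, `Classical.choice`, `Quot.sound`). The
discharges `ess_L5_integrability_holds` / `ess_endpoint_holds` are the one-line applications of
these theorems to `ess_local_holder_holds`, to be appended here once Thm. 1.4 is proved.

## References

* L. Escauriaza, G. Seregin, V. Šverák, *`L_{3,∞}`-solutions of Navier–Stokes equations and
  backward uniqueness*, Uspekhi Mat. Nauk 58:2 (2003) 3–44 = Russ. Math. Surveys 58:2 (2003)
  211–250: Thm. 1.3 ((1.13) ⇒ (1.14)) and its proof in §3 ((3.1)–(3.7)), Thm. 1.4, Thm. 7.4 with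
  Remark 7.5. [EscauriazaSereginSverak2003]
* J. C. Robinson, J. L. Rodrigo, W. Sadowski, *The three-dimensional Navier–Stokes equations*
  (CUP 2016), Thm. 16.4 and §16.4, pp. 247–251 (the same architecture, Steps 1–4, from their
  Thm. 16.5 = ESS Thm. 1.4). [RobinsonRodrigoSadowski2016]
-/

noncomputable section

namespace Literature.Analysis.FluidPDE

/-- **ESS (1.14) from Theorem 1.4 alone** (Escauriaza–Seregin–Šverák 2003, Thm. 1.3,
conclusion (1.14), proved in §3 from Thm. 1.4: `v ∈ L₅(Q_{δ,T})` for every `δ > 0` by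
(3.5)–(3.7), and `v ∈ L₅(Q_{δ₀})` near `t = 0` by Thm. 7.4, "since `a ∈ L₃ ∩ J̊`"). The
`L₅(Q_T)` integrability of `L_{3,∞}` Leray–Hopf solutions of the Cauchy problem follows from the
local Hölder regularity of `L_{3,∞}` suitable pairs (`ess_local_holder`): the accepted
`ess_L5_integrability_of_local_holder_of_kato` with Kato's `L³` theory supplied by the theorem
`ess_kato_L3_local_holds`. Real proof; the discharge `ess_L5_integrability_holds` is this theorem
applied to `ess_local_holder_holds`. [cite: EscauriazaSereginSverak2003, Thm. 1.3 (1.14), §3] -/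
theorem ess_L5_integrability_of_local_holder (hLH : ess_local_holder) : ess_L5_integrability :=
  ess_L5_integrability_of_local_holder_of_kato hLH ess_kato_L3_local_holds

/-- **The endpoint criterion ns.S08 from Theorem 1.4 alone** (Escauriaza–Seregin–Šverák 2003,
Thm. 1.3 with uniqueness: "(1.14) and hence it is smooth and unique in `Q_T`"). `ess_endpoint`
follows from `ess_local_holder` (ESS Thm. 1.4): the accepted
`ess_endpoint_of_local_holder_of_kato` with Kato's `L³` theory (ESS Thm. 7.4 / Remark 7.5)
supplied by the theorem `ess_kato_L3_local_holds`; ε-regularity (Lemma 2.2), the associated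
pressure ((3.2)–(3.4)), the energy equality and Ladyzhenskaya–Prodi–Serrin regularity (Thm. 1.2)
were already theorems there. Real proof; `ess_endpoint_holds` is this theorem applied to
`ess_local_holder_holds`. [cite: EscauriazaSereginSverak2003, Thm. 1.3, §3] -/
theorem ess_endpoint_of_local_holder (hLH : ess_local_holder) : ess_endpoint :=
  ess_endpoint_of_local_holder_of_kato hLH ess_kato_L3_local_holds

end Literature.Analysis.FluidPDE

end
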